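import Summits.QuantumFields.YangMills.Theorems.UVSeamRec.Negative.PenetrationIdentityExterior
import Summits.QuantumFields.YangMills.Theorems.BalabanLadderUVSeamRecCeilingsResponseMoments
import HarnessLib

/-!
# Crux `UVSeamRec` (stmt-QuantumFields-20043): the CLASSICAL RESPONSE functional of a cube — a gauge-invariant, chart-free
# quadratic carrier for the (β) architecture of `stub_responseMomentsOdd6`

Route-posited objects (D-0016 `…Defs` file; LEAD seat `ym-spine-20043-p1` gen 8, `--supports stmt-QuantumFields-20043`).  The (β)
discharge architecture of the registered v5(α) stub (p535725/p539259, and the LEAD's p544631/p545723) needs a NAMED quadratic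
carrier `Q β R q x : LGConfig 4 G → ℝ` — «the harmonic-extension curvature at the cube centre, squared, in units βR⁴».  A linear
lattice-Poisson functional of the boundary plaquettes is not gauge-invariant for non-abelian `G` (tempered-d1 g1 MEMO §3(b));
this file types instead the CLASSICAL (β = ∞) response of the cube, built on the disprover's ground-state vocabulary
(`BoundaryLawPenetration.cubeMinimisers`, p531835):

* `tiltedMin c b q x s η` — the tilted classical cube energy `m_s(η) = inf_ζ [S_cube(ζ ⊔ η) − s·(N − plane q x (ζ ⊔ η))]`
  (`S_cube` = the boundary Wilson action of the cube `(c, b)` glued into the exterior `η`; `s ≥ 0` a tilt at the plaquette `(x, q)`);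
* `classicalResponse c b q x s η := (m_0(η) − m_s(η)) / s` — a DIFFERENCE QUOTIENT of minimum values: gauge-invariant, defined for
  EVERY exterior, CONTINUOUS in `η` (minimum of a jointly continuous function over the compact fibre), and (Danskin) for `s → 0⁺`
  it tends to the LARGEST centre deficit `N − plane q x` over the ground states; at any fixed `s ∈ (0, 1]` it DOMINATES that deficit
  (`deficit_le_classicalResponse`) and is dominated by the ground energy `m_0(η)` (`classicalResponse_le_tiltedMin_zero`) and by `2N`;
  it vanishes at the identity exterior (`classicalResponse_one`);
* `kerE_plane_eventually_ge_sub_classicalResponse` — the β → ∞ SKELETON of the (split) inequality: for every exterior and every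
  `ε > 0`, `kerE_β(plane q x)(η) ≥ N − classicalResponse s η − ε` for all large `β` (from the disprover's Laplace step
  `kerE_eventually_ge`, Hwang 1980): the quantum centre deficit at zero temperature is dominated by the classical response;
* `carrierCl C s β R q x η := β·R⁴/C · classicalResponse (x − (R+1)) (2R+3) q x s η` — the carrier in the letters of the (β)
  press-buttons (`Q β R q x η`), with `measurable_carrierCl` and `abs_carrierCl_le` (the `hQm`/`hQb` side conditions of p535725).

What (split) and (EM_Q)/(EM_lin) then SAY with `Q := carrierCl C s`: «quantum response ≤ A₀ + β × classical response + large-field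
correction» (Bałaban's background-field expansion of the cube kernel — E0′-K proper) and «the μ_β-cost of classical centre response
is ≥ c·C·Q» (semiclassical/Gaussian domination).  NOTHING of that is asserted here.  HONEST FRAMING: definitions + elementary
properties + one β → ∞ corollary of a landed Laplace lemma; not E0′, not a gap, not Clay.

References: Danskin's theorem (directional derivatives of min-functions) for the heuristics only; Hwang (1980) Thm 2.1 via p517756/p531835.
-/

set_option autoImplicit false

noncomputable section

open MeasureTheory Filter Topology
open Literature.MathematicalPhysics.QuantumFieldTheory Literature.MathematicalPhysics.QuantumLattice
open Literature.Probability.LatticeModels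
open Summit.QuantumFields.YangMills.Cruxes.OSLegsFromFemtoAndGap.DlrCollarTransfer
open Summit.QuantumFields.YangMills.Cruxes.UVSeamRec.BoundaryLawPenetration
open Summit.QuantumFields.YangMills.Cruxes.NT.BoundaryLaw (plane_eq_plaquetteObs)

namespace Summit.QuantumFields.YangMills.Cruxes.UVSeamRec.ClassicalResponse

variable {G : Type} [Group G] [TopologicalSpace G] [IsTopologicalGroup G] [CompactSpace G]
  [MeasurableSpace G] [BorelSpace G] (r : LatticeRep G)

/-! ## §1 The tilted classical cube energy and the classical response -/

/-- The tilted cube functional `ζ ↦ S_cube(ζ ⊔ η) − s·(N − plane q x (ζ ⊔ η))` on the compact fibre `G^{cubeEdges c b}`. -/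
def tiltedAction (c : Fin 4 → ℤ) (b : ℕ) (q : Fin 4 × Fin 4) (x : Fin 4 → ℤ) (s : ℝ) (η : LGConfig 4 G)
    (ζ : ↥(cubeEdges c b) → G) : ℝ :=
  wilsonBoundaryAction r.ρ (cubeEdges c b) (glueWith (cubeEdges c b) ζ η) -
    s * ((r.N : ℝ) - plane G r q x (glueWith (cubeEdges c b) ζ η))

/-- **Tilted classical cube energy** `m_s(η) := inf_ζ [S_cube(ζ ⊔ η) − s·(N − plane q x (ζ ⊔ η))]` (an attained minimum). -/
def tiltedMin (c : Fin 4 → ℤ) (b : ℕ) (q : Fin 4 × Fin 4) (x : Fin 4 → ℤ) (s : ℝ) (η : LGConfig 4 G) : ℝ :=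
  sInf (tiltedAction r c b q x s η '' Set.univ)

/-- **Classical response** of the cube `(c, b)` at the plaquette `(x, q)` to the exterior `η`, tilt `s`:
`(m_0(η) − m_s(η)) / s`.  For `s ∈ (0,1]` it dominates the centre deficit `N − plane q x` of every ground state and is dominated by the
ground energy `m_0(η)`; it is continuous in `η` and vanishes at the identity exterior. -/
def classicalResponse (c : Fin 4 → ℤ) (b : ℕ) (q : Fin 4 × Fin 4) (x : Fin 4 → ℤ) (s : ℝ) (η : LGConfig 4 G) : ℝ :=
  (tiltedMin r c b q x 0 η - tiltedMin r c b q x s η) / s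

variable {r}

omit [CompactSpace G] [BorelSpace G] in
/-- Joint continuity of the tilted cube functional in `(η, ζ)`. [folklore] -/
theorem continuous_tiltedAction_uncurry (c : Fin 4 → ℤ) (b : ℕ) (q : Fin 4 × Fin 4) (x : Fin 4 → ℤ) (s : ℝ) :
    Continuous (Function.uncurry (tiltedAction r c b q x s)) := by
  have hglue : Continuous fun p : LGConfig 4 G × (↥(cubeEdges c b) → G) => glueWith (cubeEdges c b) p.2 p.1 :=
    continuous_glueWith_prod (cubeEdges c b)
  have h : Continuous fun p : LGConfig 4 G × (↥(cubeEdges c b) → G) =>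
      wilsonBoundaryAction r.ρ (cubeEdges c b) (glueWith (cubeEdges c b) p.2 p.1) -
        s * ((r.N : ℝ) - plane G r q x (glueWith (cubeEdges c b) p.2 p.1)) :=
    ((continuous_wilsonBoundaryAction r.ρ r.continuous (cubeEdges c b)).comp hglue).sub
      (continuous_const.mul (continuous_const.sub ((continuous_plane r q x).comp hglue)))
  exact h

omit [CompactSpace G] [BorelSpace G] in
/-- Continuity of the tilted cube functional in `ζ` at fixed exterior. [folklore] -/
theorem continuous_tiltedAction (c : Fin 4 → ℤ) (b : ℕ) (q : Fin 4 × Fin 4) (x : Fin 4 → ℤ) (s : ℝ) (η : LGConfig 4 G) :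
    Continuous (tiltedAction r c b q x s η) := by
  have hglue : Continuous fun ζ : ↥(cubeEdges c b) → G => glueWith (cubeEdges c b) ζ η :=
    (continuous_glueWith_prod (cubeEdges c b)).comp (Continuous.prodMk_right η)
  have h : Continuous fun ζ : ↥(cubeEdges c b) → G =>
      wilsonBoundaryAction r.ρ (cubeEdges c b) (glueWith (cubeEdges c b) ζ η) -
        s * ((r.N : ℝ) - plane G r q x (glueWith (cubeEdges c b) ζ η)) :=
    ((continuous_wilsonBoundaryAction r.ρ r.continuous (cubeEdges c b)).comp hglue).sub
      (continuous_const.mul (continuous_const.sub ((continuous_plane r q x).comp hglue)))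
  exact h

omit [BorelSpace G] in
/-- The infimum is a minimum: `m_s(η) ≤ S − s·deficit` at every inner configuration. [folklore] -/
theorem tiltedMin_le (c : Fin 4 → ℤ) (b : ℕ) (q : Fin 4 × Fin 4) (x : Fin 4 → ℤ) (s : ℝ) (η : LGConfig 4 G)
    (ζ : ↥(cubeEdges c b) → G) : tiltedMin r c b q x s η ≤ tiltedAction r c b q x s η ζ :=
  csInf_le ((isCompact_univ.image (continuous_tiltedAction c b q x s η)).bddBelow) ⟨ζ, Set.mem_univ _, rfl⟩

omit [BorelSpace G] in
/-- The infimum is attained. [folklore] -/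
theorem exists_tiltedMin_eq (c : Fin 4 → ℤ) (b : ℕ) (q : Fin 4 × Fin 4) (x : Fin 4 → ℤ) (s : ℝ) (η : LGConfig 4 G) :
    ∃ ζ : ↥(cubeEdges c b) → G, tiltedAction r c b q x s η ζ = tiltedMin r c b q x s η := by
  have h := (isCompact_univ.image (continuous_tiltedAction (r := r) c b q x s η)).sInf_mem
    (Set.univ_nonempty.image _)
  obtain ⟨ζ, -, hζ⟩ := h
  exact ⟨ζ, hζ⟩

omit [BorelSpace G] in
/-- A lower bound valid at every inner configuration bounds the minimum from below. [folklore] -/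
theorem le_tiltedMin {c : Fin 4 → ℤ} {b : ℕ} {q : Fin 4 × Fin 4} {x : Fin 4 → ℤ} {s : ℝ} {η : LGConfig 4 G} {t : ℝ}
    (h : ∀ ζ : ↥(cubeEdges c b) → G, t ≤ tiltedAction r c b q x s η ζ) : t ≤ tiltedMin r c b q x s η := by
  obtain ⟨ζ, hζ⟩ := exists_tiltedMin_eq (r := r) c b q x s η
  rw [← hζ]; exact h ζ

omit [IsTopologicalGroup G] [CompactSpace G] [BorelSpace G] in
/-- At tilt `0` the minimum is the ground energy: the ground states are exactly the minimisers of `tiltedAction … 0`. [folklore] -/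
theorem tiltedAction_zero (c : Fin 4 → ℤ) (b : ℕ) (q : Fin 4 × Fin 4) (x : Fin 4 → ℤ) (η : LGConfig 4 G)
    (ζ : ↥(cubeEdges c b) → G) :
    tiltedAction r c b q x 0 η ζ = wilsonBoundaryAction r.ρ (cubeEdges c b) (glueWith (cubeEdges c b) ζ η) := by
  simp [tiltedAction]

omit [BorelSpace G] in
/-- A ground state realises the untilted minimum. [folklore] -/
theorem tiltedMin_zero_eq_of_mem_cubeMinimisers {c : Fin 4 → ℤ} {b : ℕ} (q : Fin 4 × Fin 4) (x : Fin 4 → ℤ)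
    {η : LGConfig 4 G} {ζ : ↥(cubeEdges c b) → G} (hζ : ζ ∈ cubeMinimisers G r c b η) :
    tiltedMin r c b q x 0 η = wilsonBoundaryAction r.ρ (cubeEdges c b) (glueWith (cubeEdges c b) ζ η) := by
  refine le_antisymm ((tiltedMin_le c b q x 0 η ζ).trans_eq (tiltedAction_zero c b q x η ζ)) ?_
  refine le_tiltedMin fun ζ' => ?_
  rw [tiltedAction_zero]
  exact hζ ζ'

omit [IsTopologicalGroup G] [CompactSpace G] [BorelSpace G] in
/-- The centre deficit is non-negative (unitarity: `Re tr r.ρ(U_p) ≤ N`). [folklore] -/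
theorem deficit_nonneg (q : Fin 4 × Fin 4) (x : Fin 4 → ℤ) (U : LGConfig 4 G) : 0 ≤ (r.N : ℝ) - plane G r q x U := by
  rw [plane_eq_plaquetteObs G r]
  linarith [plaquetteObs_le_N r x q.1 q.2 U]

omit [IsTopologicalGroup G] [CompactSpace G] [BorelSpace G] in
/-- The centre deficit is at most `2N` (unitarity: `|Re tr r.ρ(U_p)| ≤ N`). [folklore] -/
theorem deficit_le_two_mul (q : Fin 4 × Fin 4) (x : Fin 4 → ℤ) (U : LGConfig 4 G) : (r.N : ℝ) - plane G r q x U ≤ 2 * r.N := by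
  rw [plane_eq_plaquetteObs G r]
  have h := abs_plaquetteObs_le_holds r.ρ r.mem_unitary x q.1 q.2 U
  linarith [neg_abs_le (plaquetteObs r.ρ x q.1 q.2 U)]

omit [BorelSpace G] in
/-- **Domination of the ground-state centre deficit**: for `s > 0` and every ground state `ζ` of the cube with exterior `η`,
`N − plane q x (ζ ⊔ η) ≤ classicalResponse s η`.  (Proof: `m_s ≤ S(ζ) − s·deficit(ζ) = m_0 − s·deficit(ζ)`.) [folklore] -/
theorem deficit_le_classicalResponse {c : Fin 4 → ℤ} {b : ℕ} (q : Fin 4 × Fin 4) (x : Fin 4 → ℤ) {s : ℝ} (hs : 0 < s)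
    {η : LGConfig 4 G} {ζ : ↥(cubeEdges c b) → G} (hζ : ζ ∈ cubeMinimisers G r c b η) :
    (r.N : ℝ) - plane G r q x (glueWith (cubeEdges c b) ζ η) ≤ classicalResponse r c b q x s η := by
  unfold classicalResponse
  rw [le_div_iff₀ hs, tiltedMin_zero_eq_of_mem_cubeMinimisers q x hζ]
  have h := tiltedMin_le (r := r) c b q x s η ζ
  unfold tiltedAction at h
  linarith

omit [BorelSpace G] in
/-- The classical response is non-negative for `s > 0`. [folklore] -/
theorem classicalResponse_nonneg (c : Fin 4 → ℤ) (b : ℕ) (q : Fin 4 × Fin 4) (x : Fin 4 → ℤ) {s : ℝ} (hs : 0 < s)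
    (η : LGConfig 4 G) : 0 ≤ classicalResponse r c b q x s η := by
  obtain ⟨ζ, hζ⟩ := cubeMinimisers_nonempty (G := G) (r := r) c b η
  exact (deficit_nonneg q x _).trans (deficit_le_classicalResponse q x hs hζ)

omit [BorelSpace G] in
/-- The classical response is at most `2N` for `s > 0` (`m_s ≥ m_0 − s·2N`). [folklore] -/
theorem classicalResponse_le_two_mul (c : Fin 4 → ℤ) (b : ℕ) (q : Fin 4 × Fin 4) (x : Fin 4 → ℤ) {s : ℝ} (hs : 0 < s)
    (η : LGConfig 4 G) : classicalResponse r c b q x s η ≤ 2 * r.N := by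
  unfold classicalResponse
  rw [div_le_iff₀ hs]
  have h : tiltedMin r c b q x 0 η - s * (2 * r.N) ≤ tiltedMin r c b q x s η := by
    refine le_tiltedMin fun ζ => ?_
    have h0 := tiltedMin_le (r := r) c b q x 0 η ζ
    rw [tiltedAction_zero] at h0
    unfold tiltedAction
    have hd := deficit_le_two_mul (r := r) q x (glueWith (cubeEdges c b) ζ η)
    nlinarith
  linarith

omit [IsTopologicalGroup G] [CompactSpace G] [BorelSpace G] in
/-- **The centre plaquette is part of the cube energy**: at depth `≥ 2`, `N − plane q x (U) ≤ S_cube(U)` for `q.1 < q.2`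
(one non-negative summand of the boundary Wilson action). [folklore] -/
theorem deficit_le_wilsonBoundaryAction {c : Fin 4 → ℤ} {b : ℕ} {x : Fin 4 → ℤ} (q : Fin 4 × Fin 4) (hq : q.1 < q.2)
    (hx : 2 ≤ depth c b x) (U : LGConfig 4 G) :
    (r.N : ℝ) - plane G r q x U ≤ wilsonBoundaryAction r.ρ (cubeEdges c b) U := by
  rw [plane_eq_plaquetteObs G r]
  unfold wilsonBoundaryAction
  have hmem := mem_plaquettesTouching_cubeEdges (c := c) (b := b) hx ⟨q, hq⟩
  refine (Finset.single_le_sum (f := fun p : ZdPlaquette 4 => (r.N : ℝ) - plaquetteObs r.ρ p.1 p.2.1.1 p.2.1.2 U)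
    (fun p _ => ?_) hmem).trans_eq' rfl
  linarith [plaquetteObs_le_N r p.1 p.2.1.1 p.2.1.2 U]

omit [BorelSpace G] in
/-- **The response is dominated by the ground energy**: for `0 < s ≤ 1`, `q.1 < q.2` and depth `≥ 2`,
`classicalResponse s η ≤ m_0(η)` (since `S − s·deficit ≥ (1 − s)·S ≥ (1 − s)·m_0`).  In particular exteriors admitting a flat
extension have zero response. [folklore] -/
theorem classicalResponse_le_tiltedMin_zero {c : Fin 4 → ℤ} {b : ℕ} {x : Fin 4 → ℤ} (q : Fin 4 × Fin 4) (hq : q.1 < q.2)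
    (hx : 2 ≤ depth c b x) {s : ℝ} (hs : 0 < s) (hs1 : s ≤ 1) (η : LGConfig 4 G) :
    classicalResponse r c b q x s η ≤ tiltedMin r c b q x 0 η := by
  unfold classicalResponse
  rw [div_le_iff₀ hs]
  have h0 : 0 ≤ tiltedMin r c b q x 0 η :=
    le_tiltedMin fun ζ => by rw [tiltedAction_zero]; exact wilsonBoundaryAction_nonneg r _ _
  have h : (1 - s) * tiltedMin r c b q x 0 η ≤ tiltedMin r c b q x s η := by
    refine le_tiltedMin fun ζ => ?_
    have hm := tiltedMin_le (r := r) c b q x 0 η ζ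
    rw [tiltedAction_zero] at hm
    have hd := deficit_le_wilsonBoundaryAction (r := r) q hq hx (glueWith (cubeEdges c b) ζ η)
    unfold tiltedAction
    nlinarith
  nlinarith

omit [BorelSpace G] in
/-- **The identity exterior has zero classical response** (`0 < s ≤ 1`, `q.1 < q.2`, depth `≥ 2`): its ground energy is `0`. [folklore] -/
theorem classicalResponse_one {c : Fin 4 → ℤ} {b : ℕ} {x : Fin 4 → ℤ} (q : Fin 4 × Fin 4) (hq : q.1 < q.2)
    (hx : 2 ≤ depth c b x) {s : ℝ} (hs : 0 < s) (hs1 : s ≤ 1) :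
    classicalResponse r c b q x s (1 : LGConfig 4 G) = 0 := by
  refine le_antisymm ?_ (classicalResponse_nonneg c b q x hs 1)
  refine (classicalResponse_le_tiltedMin_zero q hq hx hs hs1 1).trans ?_
  have h := tiltedMin_le (r := r) c b q x 0 (1 : LGConfig 4 G) (fun _ => 1)
  rw [tiltedAction_zero, glueWith_one_one, wilsonBoundaryAction_one] at h
  exact h

/-! ## §2 Continuity and measurability in the exterior -/

omit [BorelSpace G] in
/-- **The tilted minimum is continuous in the exterior** (minimum over a compact fibre of a jointly continuous function). [folklore] -/
theorem continuous_tiltedMin (c : Fin 4 → ℤ) (b : ℕ) (q : Fin 4 × Fin 4) (x : Fin 4 → ℤ) (s : ℝ) :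
    Continuous (tiltedMin r c b q x s) :=
  isCompact_univ.continuous_sInf (continuous_tiltedAction_uncurry (r := r) c b q x s)

omit [BorelSpace G] in
/-- The classical response is continuous in the exterior. [folklore] -/
theorem continuous_classicalResponse (c : Fin 4 → ℤ) (b : ℕ) (q : Fin 4 × Fin 4) (x : Fin 4 → ℤ) (s : ℝ) :
    Continuous (classicalResponse r c b q x s) :=
  ((continuous_tiltedMin c b q x 0).sub (continuous_tiltedMin c b q x s)).div_const s

/-- The classical response is measurable in the exterior. [folklore] -/
theorem measurable_classicalResponse (c : Fin 4 → ℤ) (b : ℕ) (q : Fin 4 × Fin 4) (x : Fin 4 → ℤ) (s : ℝ) :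
    Measurable (classicalResponse r c b q x s) := by
  haveI : SecondCountableTopology G :=
    (r.continuous.isClosedEmbedding r.injective).isEmbedding.secondCountableTopology
  exact (continuous_classicalResponse c b q x s).measurable

/-! ## §3 The zero-temperature skeleton of (split): the kernel deficit is dominated by the classical response -/

/-- **β → ∞ domination**: for every exterior `η`, tilt `s > 0` and `ε > 0`, eventually in `β`,
`N − classicalResponse s η − ε ≤ kerE β c b η (plane q x)` — the zero-temperature centre deficit of the cube kernel is at most the
classical response (disprover's Laplace step `kerE_eventually_ge` + `deficit_le_classicalResponse`). [cite: Hwang1980, Thm 2.1] -/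
theorem kerE_plane_eventually_ge_sub_classicalResponse (c : Fin 4 → ℤ) (b : ℕ) (q : Fin 4 × Fin 4) (x : Fin 4 → ℤ) {s : ℝ}
    (hs : 0 < s) (η : LGConfig 4 G) {ε : ℝ} (hε : 0 < ε) :
    ∀ᶠ β : ℝ in atTop, (r.N : ℝ) - classicalResponse r c b q x s η - ε ≤ kerE G r β c b η (plane G r q x) := by
  haveI : SecondCountableTopology G :=
    (r.continuous.isClosedEmbedding r.injective).isEmbedding.secondCountableTopology
  refine kerE_eventually_ge c b η (continuous_plane r q x) (fun ζ hζ => ?_) hε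
  linarith [deficit_le_classicalResponse (r := r) q x hs hζ]

/-! ## §4 The carrier in the letters of the (β) press-buttons -/

variable (r)

/-- **The classical quadratic carrier** `Q β R q x η := (β·R⁴/C) · classicalResponse_{cube of radius R+1 around x} (tilt s) η`
— the shape `Q : ℝ → ℕ → (Fin 4 × Fin 4) → (Fin 4 → ℤ) → LGConfig 4 G → ℝ` consumed by p535725/p539259/p545723. -/
def carrierCl (C s : ℝ) (β : ℝ) (R : ℕ) (q : Fin 4 × Fin 4) (x : Fin 4 → ℤ) (η : LGConfig 4 G) : ℝ :=
  β * (R : ℝ) ^ 4 / C * classicalResponse r (fun k => x k - (R + 1)) (2 * R + 3) q x s η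

variable {r}

/-- Measurability of the classical carrier (the `hQm` side condition). [folklore] -/
theorem measurable_carrierCl (C s β : ℝ) (R : ℕ) (q : Fin 4 × Fin 4) (x : Fin 4 → ℤ) :
    Measurable (carrierCl r C s β R q x) :=
  (measurable_classicalResponse _ _ q x s).const_mul _

omit [BorelSpace G] in
/-- Boundedness of the classical carrier (the `hQb` side condition): `|Q| ≤ |β|R⁴/|C| · 2N` for `s > 0`. [folklore] -/
theorem abs_carrierCl_le (C : ℝ) {s : ℝ} (hs : 0 < s) (β : ℝ) (R : ℕ) (q : Fin 4 × Fin 4) (x : Fin 4 → ℤ) (η : LGConfig 4 G) :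
    |carrierCl r C s β R q x η| ≤ |β| * (R : ℝ) ^ 4 / |C| * (2 * r.N) := by
  unfold carrierCl
  rw [abs_mul, abs_div, abs_mul, abs_pow, Nat.abs_cast,
    abs_of_nonneg (classicalResponse_nonneg _ _ q x hs η)]
  exact mul_le_mul_of_nonneg_left (classicalResponse_le_two_mul _ _ q x hs η) (by positivity)

omit [BorelSpace G] in
/-- The classical carrier is non-negative for `β ≥ 0`, `C > 0`, `s > 0`. [folklore] -/
theorem carrierCl_nonneg {C s β : ℝ} (hC : 0 < C) (hs : 0 < s) (hβ : 0 ≤ β) (R : ℕ) (q : Fin 4 × Fin 4) (x : Fin 4 → ℤ)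
    (η : LGConfig 4 G) : 0 ≤ carrierCl r C s β R q x η := by
  unfold carrierCl
  exact mul_nonneg (by positivity) (classicalResponse_nonneg _ _ q x hs η)

end Summit.QuantumFields.YangMills.Cruxes.UVSeamRec.ClassicalResponse

end
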